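import Summits.BirchSwinnertonDyer.BirchSwinnertonDyer.Theses.EdixhovenFibreFiveSeven
import Literature.NumberTheory.EllipticCurves.IsogenyPotentiallyGoodMinimalDiscriminantProofs
import HarnessLib

/-!
# Route `EdixhovenFibreFiveSeven`, support item `KPTransportInputs` (stmt-BirchSwinnertonDyer-24319):
# reduced BY NAME to modularity alone

Cell `pub/bsd-wall` (D-0145 line `route-BirchSwinnertonDyer-EdixhovenFibreFiveSeven`, rev 3), seat
`bsd-line-edix-p2` (prover, g7). The support item `KPTransportInputs` (the Literature-input bundle of the KP57
split glue `KPResidueOfCornerLow`, stmt-BirchSwinnertonDyer-24320, proved) is the conjunction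
`exists_isNewformOf ∧ dokchitser_padicValInt_minimalDiscriminantInt_eq_of_isogeny_of_not_dvd_degree` — modularity
of elliptic curves over `ℚ` in the tree's newform form (Breuil–Conrad–Diamond–Taylor 2001; cite-only) and
Dokchitser–Dokchitser 2015 Thm. 5.1 (1) (prime-to-`p` isogenies preserve `ord_p Δ_min` at a potentially good
prime). The second conjunct is now a tree THEOREM
(`Literature.NumberTheory.EllipticCurves.dokchitser_padicValInt_minimalDiscriminantInt_eq_of_isogeny_of_not_dvd_degree_holds`,
file `Literature/NumberTheory/EllipticCurves/IsogenyPotentiallyGoodMinimalDiscriminantProofs.lean`, p602515), so the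
item is equivalent to modularity alone; this file records that reduction by name. HONEST STATUS: the item stays
OPEN (conditional-result) — `exists_isNewformOf` is cite-only and is displayed, never asserted; nothing here is
progress on BSD, on Manin's conjecture, or on the crux KP57. BSD is not proved by any of this.
-/

set_option autoImplicit false
-- the Theorems namespace of this sub repeats the summit name by design (D-0017 nested layout)
set_option linter.dupNamespace false

namespace Summit.BirchSwinnertonDyer.BirchSwinnertonDyer.Theorems

/-- **`KPTransportInputs` (stmt-BirchSwinnertonDyer-24319) GRANTED modularity**: the bundle
`exists_isNewformOf ∧ dokchitser_padicValInt_minimalDiscriminantInt_eq_of_isogeny_of_not_dvd_degree` follows from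
its first conjunct alone, the Dokchitser–Dokchitser conjunct being the tree theorem
`dokchitser_padicValInt_minimalDiscriminantInt_eq_of_isogeny_of_not_dvd_degree_holds` (p602515).
[cite: DokchitserDokchitser2015LocalInvariants, Thm. 5.1 (1)] [cite: BreuilConradDiamondTaylor2001, Thm. A] -/
theorem kpTransportInputs_of_modularity
    (hnf : Literature.NumberTheory.EllipticCurves.ModularForms.exists_isNewformOf) :
    Summit.BirchSwinnertonDyer.BirchSwinnertonDyer.Theses.EdixhovenFibreFiveSeven.KPTransportInputs := by
  unfold Summit.BirchSwinnertonDyer.BirchSwinnertonDyer.Theses.EdixhovenFibreFiveSeven.KPTransportInputs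
  exact ⟨hnf,
    Literature.NumberTheory.EllipticCurves.dokchitser_padicValInt_minimalDiscriminantInt_eq_of_isogeny_of_not_dvd_degree_holds⟩

/-- The converse direction, for the record: `KPTransportInputs` is EQUIVALENT to modularity
`exists_isNewformOf` (its Dokchitser–Dokchitser conjunct being a theorem). [cite: DokchitserDokchitser2015LocalInvariants, Thm. 5.1 (1)] -/
theorem kpTransportInputs_iff_modularity :
    Summit.BirchSwinnertonDyer.BirchSwinnertonDyer.Theses.EdixhovenFibreFiveSeven.KPTransportInputs ↔
      Literature.NumberTheory.EllipticCurves.ModularForms.exists_isNewformOf :=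
  ⟨fun h => h.1, kpTransportInputs_of_modularity⟩

end Summit.BirchSwinnertonDyer.BirchSwinnertonDyer.Theorems
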